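import Summits.AtomisticToContinuum.BoseEinsteinCondensation.Theorems.BECHeatBathGapJastrowDobrushinRungModelDobrushin
import Summits.AtomisticToContinuum.BoseEinsteinCondensation.Theses.BECHeatBathGap

/-!
# Route `BECHeatBathGap` — support item `JastrowDobrushinRung` (stmt-AtomisticToContinuum-14373)

Closes stmt-AtomisticToContinuum-14373: the exact signature of
`Summit.AtomisticToContinuum.BoseEinsteinCondensation.Theses.BECHeatBathGap.JastrowDobrushinRung`.
For `0 ≤ f ≤ 1` measurable (even — not used), `1 - f²` integrable and `5N∫(1-f²) ≤ L³` (`L > 0`),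
the Jastrow law `∝ ∏_{i<j} f(x_i - x_j)² dX` on `Λ_L^N` satisfies approximate tensorisation of
variance over particle labels with constant `2`: for bounded measurable `F : Λ^N → ℂ` and bounded
measurable predictors `g_i` not depending on `x_i`,
`∫ |F - c|² P ≤ 2 ∑_i ∫ |F - g_i|² P` for `c` = the `P`-mean of `F`.

Proof (helper files `BECHeatBathGapJastrowDobrushinRung{HeatBath,Symmetry,Oscillation,Transfer,
Gap,Model,ModelDobrushin}.lean`, namespace `JastrowDobrushin`): Dobrushin's TV influence of `x_k` on
the conditional law of `x_j` is `≤ c = 2β/(1-(N-1)β)`, `β = ∫(1-f²)/L³` (partition function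
`Z_j ≥ 1 - (N-1)β` by `∏(1-ε) ≥ 1 - ∑ε`), so the row sum is `r = (N-1)c ≤ 1/2` when `Nβ ≤ 1/5`;
the random-scan Gibbs sampler contracts total oscillation at rate `1 - (1-r)/N`, which by
symmetry of the heat-bath projections in `L²(P)`, Cauchy–Schwarz along `⟨F, PⁿF⟩` and an
elementary log-convexity argument gives the Poincaré inequality `Var ≤ (1-r)⁻¹ ∑_j E Var_j`
(Wu 2006's gap `≥ 1 - r`, here without the spectral theorem); finally real/imaginary parts and
the change of measure `Leb|_{Λ^N} = L^{3N} · u^{⊗N}`. The case `N = 0` is trivial (one point).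
-/

noncomputable section

namespace Summit.AtomisticToContinuum.BoseEinsteinCondensation.Theorems

open MeasureTheory Function JastrowDobrushin
open scoped ENNReal
open Literature.MathematicalPhysics.QuantumManyBody.BoseGas in
/-- **`JastrowDobrushinRung` holds** (item stmt-AtomisticToContinuum-14373 of route
`BECHeatBathGap`): for `0 ≤ f ≤ 1` measurable with `1 - f²` integrable and `5N∫(1-f²) ≤ L³`,
the Jastrow law `∝ ∏_{i<j} f(x_i-x_j)² dX` on `Λ_L^N` satisfies approximate tensorisation of
variance over particles with constant `2`:
`min_c ∫ |F - c|² P ≤ 2 ∑_i ∫ |F - g_i|² P` for bounded measurable `F` and bounded measurable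
predictors `g_i` not depending on `x_i` (the evenness hypothesis on `f` is not needed).
Proof: Dobrushin's uniqueness condition with row sum `r ≤ 2α/(1-α) ≤ 1/2` (`α ≤ 1/5`) and the
heat-bath spectral gap `≥ 1 - r` (Wu 2006), re-proved from scratch in the `JastrowDobrushin`
helper files (oscillation contraction of the Gibbs sampler + an elementary `L²` transfer), applied
to real and imaginary parts. -/
theorem jastrowDobrushinRung_proof :
    Summit.AtomisticToContinuum.BoseEinsteinCondensation.Theses.BECHeatBathGap.JastrowDobrushinRung := by
  intro N L hL f hf hf01 _ hI h5 F g hFm hgm hM hg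
  obtain ⟨M, hM⟩ := hM
  rcases Nat.eq_zero_or_pos N with hN0 | hN
  · -- `N = 0`: the configuration space is a point and `F` is constant
    subst hN0
    refine ⟨F (fun i => Fin.elim0 i), ?_⟩
    have h0 : ∀ X : Fin 0 → Space,
        (‖F X - F (fun i => Fin.elim0 i)‖₊ : ℝ≥0∞) ^ 2 *
          ENNReal.ofReal (∏ i : Fin 0, ∏ j ∈ Finset.univ.filter (fun j => i < j),
            f (X i - X j) ^ 2) = 0 := fun X => by
      rw [Subsingleton.elim X (fun i => Fin.elim0 i), sub_self, nnnorm_zero]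
      simp
    simp_rw [h0]
    rw [lintegral_zero]
    exact bot_le
  -- `N ≥ 1`: the model
  haveI : Nonempty (Fin N) := ⟨⟨0, hN⟩⟩
  set uL : Measure Space := (ENNReal.ofReal (L ^ 3))⁻¹ • volume.restrict (box L) with huL
  haveI : IsProbabilityMeasure uL := isProbabilityMeasure_boxMeasure hL
  set wN : (Fin N → Space) → ℝ := fun X =>
    ∏ i, ∏ l ∈ Finset.univ.filter (fun l => i < l), f (X i - X l) ^ 2 with hwN
  set πN : Fin N → (Fin N → Space) → ℝ := fun j X => ∏ k ∈ Finset.univ.erase j,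
    (if k < j then f (X k - X j) ^ 2 else f (X j - X k) ^ 2) with hπN
  set BN : Fin N → (Fin N → Space) → ℝ := fun j X =>
    ∏ i, ∏ l ∈ Finset.univ.filter (fun l => i < l),
      (if i = j ∨ l = j then 1 else f (X i - X l) ^ 2) with hBN
  set S' : Fin N → ((Fin N → Space) → ℝ) → (Fin N → Space) → ℝ :=
    fun j G X => ∫ y, G (update X j y) ∂uL with hS'
  set T' : Fin N → ((Fin N → Space) → ℝ) → (Fin N → Space) → ℝ :=
    fun j G X => S' j (fun Y => G Y * πN j Y) X / S' j (πN j) X with hT'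
  set P' : ((Fin N → Space) → ℝ) → (Fin N → Space) → ℝ :=
    fun G X => (Fintype.card (Fin N) : ℝ)⁻¹ * ∑ j, T' j G X with hP'
  set ν : Measure (Fin N → Space) := Measure.pi fun _ : Fin N => uL with hν
  -- weight facts
  have hwm : Measurable wN :=
    Finset.measurable_prod _ fun i _ => Finset.measurable_prod _ fun l _ =>
      measurable_pairFactor hf i l
  have hw01 : ∀ X, 0 ≤ wN X ∧ wN X ≤ 1 := fun X =>
    ⟨Finset.prod_nonneg fun i _ => Finset.prod_nonneg fun l _ => sq_nonneg _,
      Finset.prod_le_one (fun i _ => Finset.prod_nonneg fun l _ => sq_nonneg _) fun i _ =>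
        Finset.prod_le_one (fun l _ => sq_nonneg _) fun l _ =>
          pow_le_one₀ (hf01 _).1 (hf01 _).2⟩
  -- the real-valued theorem, for real and imaginary parts
  have AT : ∀ (Fr : (Fin N → Space) → ℝ) (gr : Fin N → (Fin N → Space) → ℝ),
      Measurable Fr → (∀ X, |Fr X| ≤ M) → (∀ j, Measurable (gr j)) → (∀ j X, |gr j X| ≤ M) →
      (∀ j X y, gr j (update X j y) = gr j X) →
      ∫ X, (Fr X - (∫ Y, Fr Y * wN Y ∂ν) / (∫ Y, wN Y ∂ν)) ^ 2 * wN X ∂ν ≤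
        2 * ∑ j, ∫ X, (Fr X - gr j X) ^ 2 * wN X ∂ν :=
    fun Fr gr hFrm hFrb hgrm hgrb hgr =>
      model_AT hL hf hf01 hI h5 hN huL (S' := S') (T' := T') (πN := πN) (BN := BN) (wN := wN)
        (fun _ _ _ => rfl) (fun _ _ _ => rfl) (fun _ _ => rfl) (fun _ _ => rfl) (fun _ => rfl)
        (P' := P') (fun _ _ => rfl) hFrm hFrb hgrm hgrb hgr
  have h1 := AT (fun X => (F X).re) (fun i X => (g i X).re) (Complex.measurable_re.comp hFm)
    (fun X => (Complex.abs_re_le_norm _).trans (hM X).1)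
    (fun i => Complex.measurable_re.comp (hgm i))
    (fun i X => (Complex.abs_re_le_norm _).trans ((hM X).2 i)) (fun i X y => by simp only [hg])
  have h2 := AT (fun X => (F X).im) (fun i X => (g i X).im) (Complex.measurable_im.comp hFm)
    (fun X => (Complex.abs_im_le_norm _).trans (hM X).1)
    (fun i => Complex.measurable_im.comp (hgm i))
    (fun i X => (Complex.abs_im_le_norm _).trans ((hM X).2 i)) (fun i X y => by simp only [hg])
  set c₁ : ℝ := (∫ Y, (F Y).re * wN Y ∂ν) / (∫ Y, wN Y ∂ν) with hc₁
  set c₂ : ℝ := (∫ Y, (F Y).im * wN Y ∂ν) / (∫ Y, wN Y ∂ν) with hc₂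
  refine ⟨⟨c₁, c₂⟩, ?_⟩
  -- the complex inequality for Bochner integrals against `ν`
  have hM0 : 0 ≤ M := (norm_nonneg _).trans (hM (fun _ => 0)).1
  have iR : ∀ (G : (Fin N → Space) → ℝ), Measurable G → (∀ X, |G X| ≤ M + (|c₁| + |c₂| + M)) →
      Integrable (fun X => G X ^ 2 * wN X) ν := fun G hGm hGb =>
    integrable_mul_w (hGm.pow_const 2) (C := (M + (|c₁| + |c₂| + M)) ^ 2) (fun X => by
      rw [abs_pow]; exact pow_le_pow_left₀ (abs_nonneg _) (hGb X) 2) hwm hw01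
  have hreal : ∫ X, ‖F X - ⟨c₁, c₂⟩‖ ^ 2 * wN X ∂ν ≤
      2 * ∑ i, ∫ X, ‖F X - g i X‖ ^ 2 * wN X ∂ν := by
    have e1 : (fun X => ‖F X - ⟨c₁, c₂⟩‖ ^ 2 * wN X) =
        fun X => ((F X).re - c₁) ^ 2 * wN X + ((F X).im - c₂) ^ 2 * wN X := by
      funext X
      rw [Complex.sq_norm, Complex.normSq_apply, Complex.sub_re, Complex.sub_im]
      ring
    have e2 : ∀ i, (fun X => ‖F X - g i X‖ ^ 2 * wN X) =
        fun X => ((F X).re - (g i X).re) ^ 2 * wN X + ((F X).im - (g i X).im) ^ 2 * wN X := by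
      intro i; funext X
      rw [Complex.sq_norm, Complex.normSq_apply, Complex.sub_re, Complex.sub_im]
      ring
    rw [e1, integral_add]
    rotate_left
    · exact iR _ ((Complex.measurable_re.comp hFm).sub measurable_const) fun X =>
        (abs_sub _ _).trans (add_le_add ((Complex.abs_re_le_norm _).trans (hM X).1)
          (by linarith [abs_nonneg c₂]))
    · exact iR _ ((Complex.measurable_im.comp hFm).sub measurable_const) fun X =>
        (abs_sub _ _).trans (add_le_add ((Complex.abs_im_le_norm _).trans (hM X).1)
          (by linarith [abs_nonneg c₁]))
    have e3 : ∀ i, ∫ X, ‖F X - g i X‖ ^ 2 * wN X ∂ν =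
        ∫ X, ((F X).re - (g i X).re) ^ 2 * wN X ∂ν +
          ∫ X, ((F X).im - (g i X).im) ^ 2 * wN X ∂ν := by
      intro i
      rw [e2 i, integral_add]
      · exact iR _ ((Complex.measurable_re.comp hFm).sub (Complex.measurable_re.comp (hgm i)))
          fun X => (abs_sub _ _).trans (add_le_add ((Complex.abs_re_le_norm _).trans (hM X).1)
            (by linarith [abs_nonneg c₁, abs_nonneg c₂,
              (Complex.abs_re_le_norm _).trans ((hM X).2 i)]))
      · exact iR _ ((Complex.measurable_im.comp hFm).sub (Complex.measurable_im.comp (hgm i)))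
          fun X => (abs_sub _ _).trans (add_le_add ((Complex.abs_im_le_norm _).trans (hM X).1)
            (by linarith [abs_nonneg c₁, abs_nonneg c₂,
              (Complex.abs_im_le_norm _).trans ((hM X).2 i)]))
    simp_rw [e3]
    rw [Finset.sum_add_distrib, mul_add]
    exact add_le_add h1 h2
  -- conversion to the lower Lebesgue integrals over `Λ_L^N`
  have hconv : ∀ (G : (Fin N → Space) → ℂ), Measurable G → (∀ X, ‖G X‖ ≤ M + (|c₁| + |c₂| + M)) →
      ∫⁻ X in boxN N L, (‖G X‖₊ : ℝ≥0∞) ^ 2 * ENNReal.ofReal (wN X) =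
        (ENNReal.ofReal (L ^ 3)) ^ N * ENNReal.ofReal (∫ X, ‖G X‖ ^ 2 * wN X ∂ν) := by
    intro G hGm hGb
    rw [volume_restrict_boxN_eq_smul_pi hL N, lintegral_smul_measure, smul_eq_mul, ← huL, ← hν,
      lintegral_nnnorm_sq_mul_eq hGm hGb hwm hw01]
  have hb1 : ∀ X, ‖F X - ⟨c₁, c₂⟩‖ ≤ M + (|c₁| + |c₂| + M) := fun X =>
    (norm_sub_le _ _).trans (add_le_add (hM X).1 (by
      have := Complex.norm_le_abs_re_add_abs_im (⟨c₁, c₂⟩ : ℂ)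
      simp only at this
      linarith))
  have hb2 : ∀ i X, ‖F X - g i X‖ ≤ M + (|c₁| + |c₂| + M) := fun i X =>
    (norm_sub_le _ _).trans (add_le_add (hM X).1 (by
      linarith [(hM X).2 i, abs_nonneg c₁, abs_nonneg c₂]))
  change ∫⁻ X in boxN N L, (‖F X - ⟨c₁, c₂⟩‖₊ : ℝ≥0∞) ^ 2 * ENNReal.ofReal (wN X) ≤
    2 * ∑ i, ∫⁻ X in boxN N L, (‖F X - g i X‖₊ : ℝ≥0∞) ^ 2 * ENNReal.ofReal (wN X)
  have hconv2 : ∀ i, ∫⁻ X in boxN N L, (‖F X - g i X‖₊ : ℝ≥0∞) ^ 2 * ENNReal.ofReal (wN X) =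
      (ENNReal.ofReal (L ^ 3)) ^ N * ENNReal.ofReal (∫ X, ‖F X - g i X‖ ^ 2 * wN X ∂ν) :=
    fun i => hconv (fun X => F X - g i X) (hFm.sub (hgm i)) (hb2 i)
  rw [hconv (fun X => F X - ⟨c₁, c₂⟩) (by fun_prop) hb1]
  simp_rw [hconv2]
  rw [← Finset.mul_sum, mul_left_comm]
  gcongr
  have hnn : ∀ i, 0 ≤ ∫ X, ‖F X - g i X‖ ^ 2 * wN X ∂ν := fun i =>
    integral_nonneg fun X => mul_nonneg (sq_nonneg _) (hw01 X).1
  calc ENNReal.ofReal (∫ X, ‖F X - ⟨c₁, c₂⟩‖ ^ 2 * wN X ∂ν)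
      ≤ ENNReal.ofReal (2 * ∑ i, ∫ X, ‖F X - g i X‖ ^ 2 * wN X ∂ν) :=
        ENNReal.ofReal_le_ofReal hreal
    _ = 2 * ∑ i, ENNReal.ofReal (∫ X, ‖F X - g i X‖ ^ 2 * wN X ∂ν) := by
        rw [ENNReal.ofReal_mul (by norm_num), ENNReal.ofReal_ofNat,
          ENNReal.ofReal_sum_of_nonneg fun i _ => hnn i]

end Summit.AtomisticToContinuum.BoseEinsteinCondensation.Theorems
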